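import Summits.NavierStokesRegularity.FluidComputer.GateBudgetSwingFloorLock
import HarnessLib

/-!
# GateBudget part 114 — the swing transfer from below, VI: the cross term kept (§302–§304)

Cell `pub-fluidc`, blueprint seat bp1 (gen 39, ninth item); namespace
`Summit.NavierStokesRegularity.FluidComputer.GateBudget`, headline family
`RotorKnob.rotorCircuit K M ε ρ` (modes `0 = a` carrier, `1 = b` clock, `2 = c` trigger,
`3 = d` transfer, `4 = ã` output) from `delayInit`, trigger primitive `C` (`C' = c`); §304 on the
headline member `M = K¹⁰` and the UNIT lattice `ε = K¹⁰ρ²`. Imports part 111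
(`GateBudgetSwingFloorLock`: the co-rotating comparison `transfer_sq_ge_corot`, the crude lock,
the headline band floor; through it parts 99–110).
HONEST FRAMING: a low prior, high value-of-information experiment on Tao's machine paradigm;
NOT a claim that NS blows up. Nothing here is about the Navier–Stokes equations.

THE POINT (SPEC-INPUT-bp1 §CJ(3)(b)(ii); first file of the cross-term floor). The swing floor
of parts 109–113 locks the transfer mode from below CRUDELY: part 111 §296(b) drops the cross
term of `(a(r) sin Φ + d(r) cos Φ)²` at the price `-|d(r)|`, so the drift `E` charges the
transfer at ignition LINEARLY and part 113's re-count needs `|d(rₙ)| ≤ 10⁻³`. Two exact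
devices remove the charge. (§303) THE CO-ROTATING LOCK: `(a sin Φ + d cos Φ)² = A sin²(Φ + φ₀)`
EXACTLY, with the pair energy `A = a² + d²` and the pair phase `φ₀ = arctan(d/a)` — so part
111 §296(a) reads `A(sin²(Φ + φ₀) - E') ≤ d(u)²` with the SHORT drift `E' = 6L(T' - r)/A`
(`L = ε + ρ²e^{-K¹⁰} + Kã(T')`; no `|d(r)|`, no `d(r)²`), which is the phase-locking hypothesis
of parts 109/110 with a genuine offset `φ₀`. (§302) THE SIGNED BAND FLOOR: with `φ₀ ≠ 0` the
offsets `ψ₁`, `ψ₂` of the two half bands are no longer small, and part 110 §294's pricing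
`-(|sin 2ψ₁| + |sin 2ψ₂|)(1 - sin α₁)` of the primitive's `sin 2ψ·sin w` terms would cost
`≈ 1.5|φ₀|`; but the two terms carry OPPOSITE signs and cancel: `ψ₁ + ψ₂ = -(2α₁ + ε⁻¹M(C(t₂)
- C(t₁))) = -(π + s)` whatever `φ₀` and `r` are, where the band's phase excess
`s = ε⁻¹M(C(t₂) - C(t₁)) - (π - 2α₁)` satisfies `-2δ ≤ s ≤ (π - 2α₁)(κ⁻¹ - 1)` (part 109
§292(a), and the midpoint angle `ω ≤ π/2`), so `|sin 2ψ₁ + sin 2ψ₂| = 2|sin s·cos(ψ₁ - ψ₂)|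
≤ 2(π(κ⁻¹ - 1) + 2δ)`: §294 holds with `-(|sin 2ψ₁| + |sin 2ψ₂|)` replaced by
`-2(π(κ⁻¹ - 1) + 2δ)` — `≈ -6.7·10⁻⁴` on the headline member (`κ = 9999/10000`, `δ = 10⁻⁵`)
instead of part 112's `-0.0196`. (§304) THE HEADLINE BAND FLOOR WITH THE CROSS TERM: part 111
§297(b) re-run on §302–§303: coefficient `K·A·η/(ε⁻¹K¹⁰κR₂) ≥ (999/1000)·A/(θK⁹)` with
`A = a(r)² + d(r)²`, bracket `(cos 2ψ₁ + cos 2ψ₂)(cos α₁ - 1675/10⁷) - 2(π/9999 + 2/10⁵)(1 - sin α₁)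
+ 2E₁'(log tan(α₁/2))`, `E₁' = E' + π/9999`. The sequel prices `cos 2ψ₁ + cos 2ψ₂
≥ 2cos 2φ₀ - 4|ψ₁ - φ₀| - 2|s|` with `A cos 2φ₀ = a(r)² - d(r)²` and re-counts part 72 §219
WITHOUT a small-transfer hypothesis.

* §302 `swingPrim_eval_ge_signed` (part 109 §291(d) with the `sin 2ψ` term kept exactly);
  `swing_transfer_band_ge_signed` (part 110 §294 with `-2(π(κ⁻¹ - 1) + 2δ)(1 - sin α₁)`).
* §303 `corot_sq_eq` (`(sin Φ·a + cos Φ·d)² = (a² + d²) sin²(Φ + arctan(d/a))`, `a ≠ 0`);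
  `phase_lock_corot_ge` (`A(sin²(Φ + φ₀) - 6L(T' - r)/A) ≤ d(u)²`).
* §304 `swing_band_headline_ge_corot` (THE HEADLINE BAND FLOOR WITH THE CROSS TERM).

NUMBERS (headline member). `π(κ⁻¹ - 1) + 2δ = π/9999 + 2/10⁵ ≤ 3.35·10⁻⁴`; the signed linear
term costs `≤ 2·3.35·10⁻⁴·(1 - 0.2479) = 5.0·10⁻⁴` of the bracket (part 112 §298: `1.96·10⁻²`);
`E'·A = 6L(T' - r) ≤ 10⁻⁴` on a pulse `T' - r ≤ 242/K⁹` (part 113 §300), against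
`E·a² = |d(r)| + d(r)² + 6L(T' - r)`.
HONEST LIMITS. (i) This file is the band law only: the pricing of `cos 2ψ₁ + cos 2ψ₂` through
`φ₀` and the re-count are the sequel's; (ii) `a(r) ≠ 0` is needed to name `φ₀ = arctan(d/a)`
(on a clean run `a(r)² ≥ 0.96`); (iii) the hypothesis `cos 2ψ₁ + cos 2ψ₂ ≥ 0` of §294 stays
(true for `|φ₀| ≤ 0.7`); (iv) `k = 1` in §304; (v) nothing about NS.
[cite: Tao2016AveragedNS, §5.5 Theorem 5.3, (5.5), (5.6), (b-eq), (c-eq), (d-eq), (ta-eq),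
(energy-con)]
-/

noncomputable section

namespace Summit.NavierStokesRegularity.FluidComputer.GateBudget

open Real Set Filter Topology
open Literature.Analysis.FluidPDE.Tao2016AveragedNS

variable {K M ε ρ : ℝ} {X : ℝ → Fin 5 → ℝ} {C : ℝ → ℝ}

/-! ## §302 The signed band floor -/

/-- §302(a) THE HALF-BAND VALUE FROM BELOW, SIGNED (part 109 §291(d) with the cross term kept
exactly): for `E₁ ≥ 0`, `0 < α₁ ≤ w ≤ π/2`: `P(w) - P(α₁) ≥ (cos²ψ - sin²ψ)(cos α₁ - cos w)
+ sin 2ψ·(sin w - sin α₁) + E₁·log tan(α₁/2)` (`(sin²ψ - E₁)(log tan(w/2) - log tan(α₁/2))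
≥ E₁·log tan(α₁/2)` as there). [derived: part 109 §291(d)] -/
theorem swingPrim_eval_ge_signed (ψ : ℝ) {E₁ α₁ w : ℝ} (hE : 0 ≤ E₁) (hα : 0 < α₁)
    (hαw : α₁ ≤ w) (hw : w ≤ π / 2) :
    (cos ψ ^ 2 - sin ψ ^ 2) * (cos α₁ - cos w) + sin (2 * ψ) * (sin w - sin α₁)
        + E₁ * (log (sin (α₁ / 2)) - log (cos (α₁ / 2)))
      ≤ swingPrim ψ (-E₁) w - swingPrim ψ (-E₁) α₁ := by
  have hπ := Real.pi_pos
  have hSα : 0 < sin (α₁ / 2) := Real.sin_pos_of_pos_of_lt_pi (by linarith) (by linarith)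
  have hSw : 0 < sin (w / 2) := Real.sin_pos_of_pos_of_lt_pi (by linarith) (by linarith)
  have hCw : 0 < cos (w / 2) := Real.cos_pos_of_mem_Ioo ⟨by linarith, by linarith⟩
  have hSmono : sin (α₁ / 2) ≤ sin (w / 2) :=
    Real.sin_le_sin_of_le_of_le_pi_div_two (by linarith) (by linarith) (by linarith)
  have hCmono : cos (w / 2) ≤ cos (α₁ / 2) :=
    Real.cos_le_cos_of_nonneg_of_le_pi (by linarith) (by linarith) (by linarith)
  have hSC : sin (w / 2) ≤ cos (w / 2) := by
    rw [← Real.sin_pi_div_two_sub]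
    exact Real.sin_le_sin_of_le_of_le_pi_div_two (by linarith) (by linarith) (by linarith)
  have hlogw : log (sin (w / 2)) - log (cos (w / 2)) ≤ 0 := by
    linarith only [Real.log_le_log hSw hSC]
  have hlogmono : log (sin (α₁ / 2)) - log (cos (α₁ / 2))
      ≤ log (sin (w / 2)) - log (cos (w / 2)) := by
    linarith only [Real.log_le_log hSα hSmono, Real.log_le_log hCw hCmono]
  have hlog1 : E₁ * (log (sin (α₁ / 2)) - log (cos (α₁ / 2)))
      ≤ (sin ψ ^ 2 + -E₁) * ((log (sin (w / 2)) - log (cos (w / 2)))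
          - (log (sin (α₁ / 2)) - log (cos (α₁ / 2)))) := by
    have h1 : 0 ≤ sin ψ ^ 2 * ((log (sin (w / 2)) - log (cos (w / 2)))
        - (log (sin (α₁ / 2)) - log (cos (α₁ / 2)))) :=
      mul_nonneg (sq_nonneg _) (sub_nonneg.2 hlogmono)
    have h2 : 0 ≤ E₁ * -(log (sin (w / 2)) - log (cos (w / 2))) :=
      mul_nonneg hE (by linarith only [hlogw])
    linarith only [h1, h2]
  unfold swingPrim
  linarith only [hlog1]

/-- §302(b) THE BAND FLOOR, SIGNED (EXACTLY the hypotheses of part 110 §294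
`swing_transfer_band_ge`): the same floor with `-(|sin 2ψ₁| + |sin 2ψ₂|)(1 - sin α₁)` replaced
by `-2(π(κ⁻¹ - 1) + 2δ)(1 - sin α₁)`. At the dose midpoint (`2C(t_m) = C(t₁) + C(t₂)`, common
angle `ω ∈ [α₁, π/2]`, `ε⁻¹M(C(t₂) - C(t₁)) = 2(ω - α₁)/κ`) the two signed half-band values
(§302(a)) carry `(sin 2ψ₁ + sin 2ψ₂)(sin ω - sin α₁)` with `0 ≤ sin ω - sin α₁ ≤ 1 - sin α₁`,
and `ψ₁ + ψ₂ = -(π + s)`, `s = ε⁻¹M(C(t₂) - C(t₁)) - (π - 2α₁) ∈ [-2δ, (π - 2α₁)(κ⁻¹ - 1)]`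
(part 109 §292(a); `ω ≤ π/2`), so `sin 2ψ₁ + sin 2ψ₂ = 2 sin(ψ₁ + ψ₂) cos(ψ₁ - ψ₂)` has size
`≤ 2|sin s| ≤ 2(π(κ⁻¹ - 1) + 2δ)`. [derived: part 109 §292(a)–(c); part 110 §293, §294
(verbatim up to the pricing); this file §302(a)] -/
theorem swing_transfer_band_ge_signed
    (hX : ∀ t, HasDerivAt X (RotorKnob.rotorCircuit K M ε ρ (X t)) t) (h0 : X 0 = delayInit)
    (hC : ∀ t, HasDerivAt C (X t 2) t) (hK : 0 ≤ K) (hε : 0 < ε) (hM : 0 < M)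
    (hlat : ε⁻¹ * M * ρ ^ 2 = 1) {t₁ t₂ r R₁ R₂ Q κ δ A E φ₀ α₁ ψ₁ ψ₂ E₁ η : ℝ} (ht : t₁ ≤ t₂)
    (hR : 0 < R₂) (hQ : R₂ ^ 2 + ε ^ 2 / M ≤ Q) (hκ0 : 0 < κ) (hκ1 : κ ≤ 1) (hA : 0 ≤ A)
    (hE : 0 ≤ E) (hring : ∀ u ∈ Icc t₁ t₂, Q ≤ X u 1 ^ 2 + X u 2 ^ 2)
    (hband : ∀ u ∈ Icc t₁ t₂, X u 1 ^ 2 < R₂ ^ 2)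
    (hκ : ∀ u ∈ Icc t₁ t₂, κ * X u 2 ≤ √(R₂ ^ 2 - X u 1 ^ 2))
    (hpos : ∀ u ∈ Icc t₁ t₂, 0 < X u 2) (hsym : X t₂ 1 = -X t₁ 1) (hR₁ : 0 < R₁)
    (hring₁ : ∀ u ∈ Icc t₁ t₂, X u 1 ^ 2 + X u 2 ^ 2 ≤ R₁ ^ 2) (hδ0 : 0 ≤ δ)
    (hδ : ∀ u ∈ Icc t₁ t₂, |arccos (X u 1 / R₁) - arccos (X u 1 / R₂)| ≤ δ)
    (hd : ∀ u ∈ Icc t₁ t₂, A * (sin ((C u - C r) / ρ ^ 2 + φ₀) ^ 2 - E) ≤ X u 3 ^ 2)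
    (hα₁ : α₁ = arccos (X t₁ 1 / R₂)) (hψ₁ : ψ₁ = (C t₁ - C r) / ρ ^ 2 + φ₀ - α₁)
    (hψ₂ : ψ₂ = -(α₁ + ((C t₁ - C r) / ρ ^ 2 + φ₀) + ε⁻¹ * M * (C t₂ - C t₁)))
    (hE₁ : E₁ = E + π * (κ⁻¹ - 1)) (hη : η = κ / (1 + (2 * δ + π / 2 * (κ⁻¹ - 1)) / sin α₁))
    (hcψ : 0 ≤ cos ψ₁ ^ 2 - sin ψ₁ ^ 2 + (cos ψ₂ ^ 2 - sin ψ₂ ^ 2)) :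
    K * A * η / (ε⁻¹ * M * κ * R₂) *
        ((cos ψ₁ ^ 2 - sin ψ₁ ^ 2 + (cos ψ₂ ^ 2 - sin ψ₂ ^ 2))
            * (cos α₁ - ((1 - κ) * (π / 2) + δ))
          - 2 * (π * (κ⁻¹ - 1) + 2 * δ) * (1 - sin α₁)
          + 2 * E₁ * (log (sin (α₁ / 2)) - log (cos (α₁ / 2))))
      ≤ X t₂ 4 - X t₁ 4 := by
  -- a dose midpoint exists (part 110 §294 verbatim)
  have hcont : ContinuousOn C (Icc t₁ t₂) := fun u _ => (hC u).continuousAt.continuousWithinAt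
  have hCm := Thm53.monotoneOn_sub_of_le_deriv (f := C) (f' := fun u => X u 2)
    (Φ := fun _ => (0 : ℝ)) (φ := fun _ => 0) (convex_Icc t₁ t₂) (fun u _ => hC u)
    (fun u _ => hasDerivAt_const u 0) (fun u hu => (hpos u hu).le)
  have hc12 := hCm (left_mem_Icc.2 ht) (right_mem_Icc.2 ht) ht
  dsimp only at hc12
  have hmid : (C t₁ + C t₂) / 2 ∈ Icc (C t₁) (C t₂) := by
    constructor <;> linarith only [hc12]
  obtain ⟨tm, htm, hCtm⟩ := intermediate_value_Icc ht hcont hmid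
  have hle : 2 * C tm ≤ C t₁ + C t₂ := by rw [hCtm]; linarith only
  have hge : C t₁ + C t₂ ≤ 2 * C tm := by rw [hCtm]; linarith only
  -- the two half-band laws from below at the midpoint
  obtain ⟨hη0, -, hα0, hc1, hwπ, h1⟩ := swing_transfer_first_ge hX h0 hC hK hε hM hlat ht hR hQ
    hκ0 hκ1 hA hring hband hκ hpos hsym hR₁ hring₁ hδ0 hδ hd hα₁ hψ₁ hE₁ hη htm hle
  obtain ⟨-, -, -, -, -, h2⟩ := swing_transfer_second_ge hX h0 hC hK hε hM hlat ht hR hQ hκ0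
    hκ1 hA hring hband hκ hpos hsym hR₁ hring₁ hδ0 hδ hd hα₁ hψ₂ hE₁ hη htm hge
  have hvw : C t₂ - C tm = C tm - C t₁ := by rw [hCtm]; ring
  rw [hvw] at h2
  obtain ⟨-, hcos⟩ := swing_midpoint_angle hX hC hε hM.le ht hR₁ hring₁ hpos hδ hsym hκ0 hκ1
    hα₁ hα0 htm hge hwπ
  obtain ⟨ω, hω⟩ : ∃ ω : ℝ, ω = α₁ + ε⁻¹ * M * κ * (C tm - C t₁) := ⟨_, rfl⟩
  rw [← hω] at h1 h2 hcos hwπ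
  have hκinv : 0 ≤ κ⁻¹ - 1 := sub_nonneg.2 ((one_le_inv₀ hκ0).2 hκ1)
  have hE₁0 : 0 ≤ E₁ := by rw [hE₁]; positivity
  have hlam0 : 0 < ε⁻¹ * M * κ := by positivity
  have hαω : α₁ ≤ ω := by
    rw [hω]
    have := mul_nonneg hlam0.le (sub_nonneg.2 hc1)
    linarith only [this]
  have hev1 := swingPrim_eval_ge_signed ψ₁ hE₁0 hα0 hαω hwπ
  have hev2 := swingPrim_eval_ge_signed ψ₂ hE₁0 hα0 hαω hwπ
  have hcoef : 0 ≤ K * A * η / (ε⁻¹ * M * κ * R₂) := by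
    have := hη0.le
    positivity
  -- `sin` rises on `[α₁, ω] ⊆ [0, π/2]`
  have hsin : sin α₁ ≤ sin ω := Real.sin_le_sin_of_le_of_le_pi_div_two (by linarith) hwπ hαω
  have hsin1 : sin ω ≤ 1 := sin_le_one ω
  -- the band's phase excess `s`: `ψ₁ + ψ₂ = -(s + π)`, `-2δ ≤ s ≤ π(κ⁻¹ - 1)`
  obtain ⟨s, hs⟩ : ∃ s : ℝ, s = ε⁻¹ * M * (C t₂ - C t₁) - (π - 2 * α₁) := ⟨_, rfl⟩
  have hsum : ψ₁ + ψ₂ = -(s + π) := by rw [hψ₁, hψ₂, hs]; ring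
  obtain ⟨-, -, hlow⟩ := swing_window_upper hX hC hε hM.le ht hR₁ hring₁ hpos hδ hsym
    (left_mem_Icc.2 ht)
  rw [← hα₁] at hlow
  have hslo : -(2 * δ) ≤ s := by rw [hs]; linarith only [hlow]
  have hadv : ε⁻¹ * M * (C t₂ - C t₁) = 2 * (ω - α₁) / κ := by
    rw [hω, hCtm]; field_simp; ring
  have hshi : s ≤ π * (κ⁻¹ - 1) := by
    have h3 : 2 * (ω - α₁) / κ ≤ (π - 2 * α₁) / κ :=
      div_le_div_of_nonneg_right (by linarith only [hwπ]) hκ0.le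
    have h4 : (π - 2 * α₁) / κ = (π - 2 * α₁) * κ⁻¹ := div_eq_mul_inv _ _
    have h5 : (π - 2 * α₁) * (κ⁻¹ - 1) ≤ π * (κ⁻¹ - 1) :=
      mul_le_mul_of_nonneg_right (by linarith only [hα0]) hκinv
    rw [hs, hadv]
    nlinarith only [h3, h4, h5]
  have hsabs : |s| ≤ π * (κ⁻¹ - 1) + 2 * δ :=
    abs_le.2 ⟨by nlinarith only [hslo, hκinv, Real.pi_pos], by linarith only [hshi, hδ0]⟩
  -- the two cross terms cancel up to `2|sin s|`
  have hS : |sin (2 * ψ₁) + sin (2 * ψ₂)| ≤ 2 * (π * (κ⁻¹ - 1) + 2 * δ) := by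
    have e1 : sin (2 * ψ₁)
        = sin (ψ₁ + ψ₂) * cos (ψ₁ - ψ₂) + cos (ψ₁ + ψ₂) * sin (ψ₁ - ψ₂) := by
      rw [← sin_add]; congr 1; ring
    have e3 : sin (2 * ψ₂)
        = sin (ψ₁ + ψ₂) * cos (ψ₁ - ψ₂) - cos (ψ₁ + ψ₂) * sin (ψ₁ - ψ₂) := by
      rw [← sin_sub]; congr 1; ring
    have e : sin (2 * ψ₁) + sin (2 * ψ₂) = 2 * sin (ψ₁ + ψ₂) * cos (ψ₁ - ψ₂) := by
      rw [e1, e3]; ring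
    have e2 : sin (ψ₁ + ψ₂) = sin s := by
      rw [hsum, sin_neg, sin_add_pi, neg_neg]
    rw [e, e2, abs_mul, abs_mul, abs_two]
    have h6 : |sin s| ≤ |s| := abs_sin_le_abs
    have h7 : |cos (ψ₁ - ψ₂)| ≤ 1 := abs_cos_le_one _
    have h8 : |sin s| * |cos (ψ₁ - ψ₂)| ≤ |s| * 1 :=
      mul_le_mul h6 h7 (abs_nonneg _) (abs_nonneg _)
    linarith only [h8, hsabs]
  have hlin : -(2 * (π * (κ⁻¹ - 1) + 2 * δ) * (1 - sin α₁))
      ≤ (sin (2 * ψ₁) + sin (2 * ψ₂)) * (sin ω - sin α₁) := by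
    have h6 : -|sin (2 * ψ₁) + sin (2 * ψ₂)| * (sin ω - sin α₁)
        ≤ (sin (2 * ψ₁) + sin (2 * ψ₂)) * (sin ω - sin α₁) :=
      mul_le_mul_of_nonneg_right (neg_abs_le _) (by linarith only [hsin])
    have h7 : |sin (2 * ψ₁) + sin (2 * ψ₂)| * (sin ω - sin α₁)
        ≤ 2 * (π * (κ⁻¹ - 1) + 2 * δ) * (1 - sin α₁) :=
      mul_le_mul hS (by linarith only [hsin1]) (by linarith only [hsin]) (by positivity)
    linarith only [h6, h7]
  -- the midpoint cosine bound enters with the sign of `cos 2ψ₁ + cos 2ψ₂`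
  have hm := mul_le_mul_of_nonneg_left
    (sub_le_sub_left hcos (cos α₁) :
      cos α₁ - ((1 - κ) * (π / 2) + δ) ≤ cos α₁ - cos ω) hcψ
  have key : (cos ψ₁ ^ 2 - sin ψ₁ ^ 2 + (cos ψ₂ ^ 2 - sin ψ₂ ^ 2))
            * (cos α₁ - ((1 - κ) * (π / 2) + δ))
          - 2 * (π * (κ⁻¹ - 1) + 2 * δ) * (1 - sin α₁)
          + 2 * E₁ * (log (sin (α₁ / 2)) - log (cos (α₁ / 2)))
      ≤ (swingPrim ψ₁ (-E₁) ω - swingPrim ψ₁ (-E₁) α₁)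
          + (swingPrim ψ₂ (-E₁) ω - swingPrim ψ₂ (-E₁) α₁) := by
    linear_combination hm + hev1 + hev2 + hlin
  have hfin := mul_le_mul_of_nonneg_left key hcoef
  rw [mul_add] at hfin
  linarith only [hfin, h1, h2]

/-! ## §303 The co-rotating lock with the cross term -/

/-- §303(a) THE CO-ROTATING IDENTITY (`a ≠ 0`): `(sin Φ·a + cos Φ·d)² = (a² + d²)·sin²(Φ + φ₀)`
with `φ₀ = arctan(d/a)` (`cos φ₀ = 1/√(1 + d²/a²)`, `sin φ₀ = (d/a)/√(1 + d²/a²)`).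
[derived: Mathlib (`Real.cos_arctan`, `Real.sin_arctan`)] -/
theorem corot_sq_eq {a d φ : ℝ} (ha : a ≠ 0) :
    (sin φ * a + cos φ * d) ^ 2 = (a ^ 2 + d ^ 2) * sin (φ + arctan (d / a)) ^ 2 := by
  obtain ⟨q, hq⟩ : ∃ q : ℝ, q = √(1 + (d / a) ^ 2) := ⟨_, rfl⟩
  have hq0 : 0 < q := by rw [hq]; positivity
  have hq2 : q ^ 2 = 1 + (d / a) ^ 2 := by rw [hq]; exact sq_sqrt (by positivity)
  have hc : cos (arctan (d / a)) = 1 / q := by rw [hq, cos_arctan]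
  have hsn : sin (arctan (d / a)) = d / a / q := by rw [hq, sin_arctan]
  rw [sin_add, hc, hsn]
  have e1 : (sin φ * (1 / q) + cos φ * (d / a / q)) = (sin φ * a + cos φ * d) / (a * q) := by
    field_simp
  rw [e1, div_pow, mul_pow]
  have haq : a ^ 2 * q ^ 2 = a ^ 2 + d ^ 2 := by
    rw [hq2]; field_simp
  rw [haq]
  have hA : a ^ 2 + d ^ 2 ≠ 0 := by positivity
  field_simp

/-- §303(b) THE CO-ROTATING LOCK FROM BELOW (headline member `M = K¹⁰`, `K, ε ≥ 0`,
`0 ≤ r ≤ u ≤ T'`, `a(r) ≠ 0`; `A = a(r)² + d(r)²`, `φ₀ = arctan(d(r)/a(r))`):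
`A·(sin²((C(u) - C(r))/ρ² + φ₀) - 6(ε + ρ²e^{-K¹⁰} + Kã(T'))(T' - r)/A) ≤ d(u)²` — part 111
§296(a) with the cross term KEPT (§303(a)); the phase-locking hypothesis of parts 109/110 with
the short drift `E' = 6L(T' - r)/A`. [derived: part 111 §296(a); this file §303(a)] -/
theorem phase_lock_corot_ge
    (hX : ∀ t, HasDerivAt X (RotorKnob.rotorCircuit K (K ^ 10) ε ρ (X t)) t)
    (h0 : X 0 = delayInit) (hC : ∀ t, HasDerivAt C (X t 2) t) (hK : 0 ≤ K) (hε : 0 ≤ ε)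
    {r u T' : ℝ} (hr : 0 ≤ r) (hru : r ≤ u) (huT : u ≤ T') (ha : X r 0 ≠ 0) :
    (X r 0 ^ 2 + X r 3 ^ 2) * (sin ((C u - C r) / ρ ^ 2 + arctan (X r 3 / X r 0)) ^ 2
      - 6 * (ε + ρ ^ 2 * exp (-K ^ 10) + K * X T' 4) * (T' - r) / (X r 0 ^ 2 + X r 3 ^ 2))
        ≤ X u 3 ^ 2 := by
  have hcor := transfer_sq_ge_corot hX h0 hC hK hε hr hru huT
  rw [corot_sq_eq ha] at hcor
  have hA : X r 0 ^ 2 + X r 3 ^ 2 ≠ 0 := by positivity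
  rw [mul_sub, mul_div_cancel₀ _ hA]
  exact hcor

/-! ## §304 The headline band floor with the cross term -/

/-- §304 THE HEADLINE BAND FLOOR WITH THE CROSS TERM (hypotheses of part 111 §297(b)
`swing_band_headline_ge`: headline member `K ≥ 16`, `ε > 0`, UNIT LATTICE `ε = K¹⁰ρ²`,
`θ ≥ 5/4`; a pulse start `r ≥ 0` and an end `T'` with the kept ring
`θ²ε² - ε²/10⁶ ≤ b² + c² ≤ θ²ε² + 2ε²/10⁶` and `c > 0` on `[r, T']`, `a(r) ≠ 0`; a symmetric band
`r ≤ t₁ ≤ t₂ ≤ T'`, `b(t₁) = (31/32)θε = -b(t₂)`, `|b| ≤ (31/32)θε` on `[t₁, t₂]`; but now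
`A = a(r)² + d(r)²`, `φ₀ = arctan(d(r)/a(r))`, the SHORT drift `E' = 6L(T' - r)/A`,
`ψ₁ = (C(t₁) - C(r))/ρ² + φ₀ - α₁`, `ψ₂ = -(α₁ + (C(t₁) - C(r))/ρ² + φ₀ + ε⁻¹K¹⁰(C(t₂) - C(t₁)))`,
`E₁ = E' + π(κ⁻¹ - 1)`, `η`, `κ = 9999/10000` as there, and `cos 2ψ₁ + cos 2ψ₂ ≥ 0`):
`(K·A·η/(ε⁻¹K¹⁰κR₂))·((cos²ψ₁ - sin²ψ₁ + cos²ψ₂ - sin²ψ₂)(cos α₁ - ((1 - κ)π/2 + 1/10⁵))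
- 2(π(κ⁻¹ - 1) + 2/10⁵)(1 - sin α₁) + 2E₁(log sin(α₁/2) - log cos(α₁/2))) ≤ ã(t₂) - ã(t₁)`.
[derived: part 103 §283(a); part 111 §297(a),(b) (verbatim up to the lock); this file §302(b),
§303(b)] -/
theorem swing_band_headline_ge_corot
    (hX : ∀ t, HasDerivAt X (RotorKnob.rotorCircuit K (K ^ 10) ε ρ (X t)) t)
    (h0 : X 0 = delayInit) (hC : ∀ t, HasDerivAt C (X t 2) t) (hK : 16 ≤ K) (hε : 0 < ε)
    (hlat : ε = K ^ 10 * ρ ^ 2) {r t₁ t₂ T' θ : ℝ} (hr : 0 ≤ r) (hrt : r ≤ t₁) (ht : t₁ ≤ t₂)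
    (htT : t₂ ≤ T') (hθ1 : 5 / 4 ≤ θ) (ha : X r 0 ≠ 0)
    (hring : ∀ u ∈ Icc r T', θ ^ 2 * ε ^ 2 - ε ^ 2 / 10 ^ 6 ≤ X u 1 ^ 2 + X u 2 ^ 2 ∧
      X u 1 ^ 2 + X u 2 ^ 2 ≤ θ ^ 2 * ε ^ 2 + 2 * ε ^ 2 / 10 ^ 6)
    (hpos : ∀ u ∈ Icc r T', 0 < X u 2) (hb1 : X t₁ 1 = 31 / 32 * θ * ε)
    (hb2 : X t₂ 1 = -(31 / 32 * θ * ε))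
    (hband : ∀ u ∈ Icc t₁ t₂, -(31 / 32 * θ * ε) ≤ X u 1 ∧ X u 1 ≤ 31 / 32 * θ * ε)
    {R₂ A φ₀ E α₁ ψ₁ ψ₂ E₁ η : ℝ}
    (hR₂ : R₂ = √(θ ^ 2 * ε ^ 2 - ε ^ 2 / 10 ^ 6 - ε ^ 2 / K ^ 10))
    (hA : A = X r 0 ^ 2 + X r 3 ^ 2) (hφ₀ : φ₀ = arctan (X r 3 / X r 0))
    (hE : E = 6 * (ε + ρ ^ 2 * exp (-K ^ 10) + K * X T' 4) * (T' - r) / A)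
    (hα₁ : α₁ = arccos (31 / 32 * θ * ε / R₂)) (hψ₁ : ψ₁ = (C t₁ - C r) / ρ ^ 2 + φ₀ - α₁)
    (hψ₂ : ψ₂ = -(α₁ + ((C t₁ - C r) / ρ ^ 2 + φ₀) + ε⁻¹ * K ^ 10 * (C t₂ - C t₁)))
    (hE₁ : E₁ = E + π * ((9999 / 10000 : ℝ)⁻¹ - 1))
    (hη : η = 9999 / 10000
      / (1 + (2 * (1 / 10 ^ 5) + π / 2 * ((9999 / 10000 : ℝ)⁻¹ - 1)) / sin α₁))
    (hcψ : 0 ≤ cos ψ₁ ^ 2 - sin ψ₁ ^ 2 + (cos ψ₂ ^ 2 - sin ψ₂ ^ 2)) :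
    K * A * η / (ε⁻¹ * K ^ 10 * (9999 / 10000) * R₂) *
        ((cos ψ₁ ^ 2 - sin ψ₁ ^ 2 + (cos ψ₂ ^ 2 - sin ψ₂ ^ 2))
            * (cos α₁ - ((1 - 9999 / 10000) * (π / 2) + 1 / 10 ^ 5))
          - 2 * (π * ((9999 / 10000 : ℝ)⁻¹ - 1) + 2 * (1 / 10 ^ 5)) * (1 - sin α₁)
          + 2 * E₁ * (log (sin (α₁ / 2)) - log (cos (α₁ / 2))))
      ≤ X t₂ 4 - X t₁ 4 := by
  have hK0 : (0 : ℝ) < K := by linarith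
  have hM : (0 : ℝ) < K ^ 10 := by positivity
  obtain ⟨hRpos, hRQ, hRlo2, hRband, -, -⟩ := headline_band_radius hK hε hθ1 hR₂
  have hlat1 : ε⁻¹ * K ^ 10 * ρ ^ 2 = 1 := by
    rw [mul_assoc, ← hlat]; exact inv_mul_cancel₀ hε.ne'
  have hrT : r ≤ T' := hrt.trans (ht.trans htT)
  have hsub : ∀ u ∈ Icc t₁ t₂, u ∈ Icc r T' := fun u hu => ⟨hrt.trans hu.1, hu.2.trans htT⟩
  -- the inner data, exactly as in part 111 §297(b)
  have hQ : R₂ ^ 2 + ε ^ 2 / K ^ 10 ≤ θ ^ 2 * ε ^ 2 - ε ^ 2 / 10 ^ 6 := hRQ.le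
  have hring2 : ∀ u ∈ Icc t₁ t₂, θ ^ 2 * ε ^ 2 - ε ^ 2 / 10 ^ 6 ≤ X u 1 ^ 2 + X u 2 ^ 2 :=
    fun u hu => (hring u (hsub u hu)).1
  have hbsq : ∀ u ∈ Icc t₁ t₂, X u 1 ^ 2 ≤ (31 / 32 * θ * ε) ^ 2 := by
    intro u hu
    obtain ⟨h1, h2⟩ := hband u hu
    exact sq_le_sq' h1 h2
  have hband2 : ∀ u ∈ Icc t₁ t₂, X u 1 ^ 2 < R₂ ^ 2 :=
    fun u hu => (hbsq u hu).trans_lt hRband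
  have hκ : ∀ u ∈ Icc t₁ t₂, 9999 / 10000 * X u 2 ≤ √(R₂ ^ 2 - X u 1 ^ 2) := by
    intro u hu
    have hup := (hring u (hsub u hu)).2
    refine band_kappa_headline hθ1 hε hRlo2 ?_ ?_
    · rw [← mul_pow, ← mul_assoc]; exact hbsq u hu
    · rw [mul_pow]; exact hup
  have hpos2 : ∀ u ∈ Icc t₁ t₂, 0 < X u 2 := fun u hu => hpos u (hsub u hu)
  have hsym : X t₂ 1 = -X t₁ 1 := by rw [hb1, hb2]
  -- the outer ring and the angle gap (part 111 §297(a))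
  obtain ⟨R₁, hR₁⟩ : ∃ R₁ : ℝ, R₁ = √(θ ^ 2 * ε ^ 2 + 2 * ε ^ 2 / 10 ^ 6) := ⟨_, rfl⟩
  have habs : ∀ u ∈ Icc t₁ t₂, |X u 1| ≤ 31 / 32 * θ * ε := fun u hu => abs_le.2 (hband u hu)
  obtain ⟨hR1pos, h1sq, -⟩ := headline_angle_gap hK hε hθ1 hR₁ hR₂ (habs t₁ ⟨le_rfl, ht⟩)
  have hring1 : ∀ u ∈ Icc t₁ t₂, X u 1 ^ 2 + X u 2 ^ 2 ≤ R₁ ^ 2 := by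
    intro u hu
    rw [h1sq]; exact (hring u (hsub u hu)).2
  have hδ : ∀ u ∈ Icc t₁ t₂, |arccos (X u 1 / R₁) - arccos (X u 1 / R₂)| ≤ 1 / 10 ^ 5 :=
    fun u hu => (headline_angle_gap hK hε hθ1 hR₁ hR₂ (habs u hu)).2.2
  -- the co-rotating lock from below (§303) on the band
  have hd : ∀ u ∈ Icc t₁ t₂, A * (sin ((C u - C r) / ρ ^ 2 + φ₀) ^ 2 - E) ≤ X u 3 ^ 2 := by
    intro u hu
    rw [hA, hφ₀, hE, hA]
    exact phase_lock_corot_ge hX h0 hC hK0.le hε.le hr (hrt.trans hu.1) (hu.2.trans htT) ha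
  have hA0 : 0 ≤ A := by rw [hA]; positivity
  have hE0 : 0 ≤ E := by
    rw [hE]
    have hT0 : 0 ≤ T' := hr.trans hrT
    have he := RotorKnob.e_nonneg hX h0 hK0.le hT0
    have hτ : 0 ≤ T' - r := by linarith
    positivity
  have hα₁' : α₁ = arccos (X t₁ 1 / R₂) := by rw [hα₁, hb1]
  exact swing_transfer_band_ge_signed hX h0 hC hK0.le hε hM hlat1 ht hRpos hQ (by norm_num)
    (by norm_num) hA0 hE0 hring2 hband2 hκ hpos2 hsym hR1pos hring1 (by norm_num) hδ hd hα₁' hψ₁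
    hψ₂ hE₁ hη hcψ

end Summit.NavierStokesRegularity.FluidComputer.GateBudget
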